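import Literature.NumberTheory.EllipticCurves.BSDQuadraticDescent
import Literature.NumberTheory.EllipticCurves.BSDSelmerParityDokchitserBaseChangeProofs
import Literature.NumberTheory.EllipticCurves.PAdicBSDKatoFiniteProofs
import HarnessLib

/-!
# The odd part of `Ш` under quadratic base change: `#Ш(E_K/K)[p^∞] = #Ш(E/ℚ)[p^∞] · #Ш(E^{(d_K)}/ℚ)[p^∞]`

Sibling *proofs* file (theorems only, no definitions, no named facts) of
`Literature.NumberTheory.EllipticCurves.BSDQuadraticDescent`, towards its named fact
`WeierstrassCurve.bsdRHS_baseChange_quadratic` (the Birch–Swinnerton-Dyer quotient of `E_K/K` is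
the product of those of `E/ℚ` and `E^{(D)}/ℚ` for a quadratic field `K` of discriminant `D`;
Milne, Invent. Math. 17 (1972), §1, Thm. 1, through Dokchitser–Dokchitser, Ann. of Math. 172
(2010), §2.1, proof of Thm. 8). This file proves the **odd-primary part of the `Ш`-term** of that
comparison, in the rank-zero shape of the fact:

* `Literature.NumberTheory.EllipticCurves.bijective_of_two_pow_nsmul_ker_of_two_pow_nsmul_coker`
  — a homomorphism of `p`-primary abelian groups, `p` odd, whose kernel and cokernel are killed by
  a power of `2` is an isomorphism (Bézout);
* `Literature.NumberTheory.EllipticCurves.comparisonMap_bijective_of_odd` — for an elliptic curve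
  `E/ℚ`, `K = ℚ(θ)` quadratic with `θ² = c`, and an ODD prime `p`, the comparison map
  `Φ : Sel_{p^∞}(E/ℚ) × Sel_{p^∞}(E^{(c)}/ℚ) → Sel_{p^∞}(E/K)`, `(η, η') ↦ res η + ψ_*(res η')`
  of `BSDSelmerParityDokchitserBaseChangeProofs` (Dokchitser–Dokchitser 2010, proof of Lemma 4.14:
  kernel killed by `4`, cokernel killed by `8` — both proved there) is an **isomorphism**
  `Sel_{p^∞}(E/ℚ) × Sel_{p^∞}(E^{(c)}/ℚ) ≅ Sel_{p^∞}(E/K)`;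
* `WeierstrassCurve.card_selmerGroupPInfty_eq_card_primaryComponent_sha` — if `E(F)` is finite
  then `Sel_{p^∞}(E/F) ≅ Ш(E/F)[p^∞]` (the fundamental sequence
  `0 → E(F) ⊗ ℚ_p/ℤ_p → Sel_{p^∞}(E/F) → Ш(E/F)[p^∞] → 0`, Greenberg 1999 §2, with
  `E(F) ⊗ ℚ_p/ℤ_p = 0`: `ker_primaryH1ToH1_eq_bot_of_finite`, `map_primaryH1ToH1_selmerGroupPInfty`),
  so the two groups have the same cardinality;
* `WeierstrassCurve.card_primaryComponent_sha_baseChange_quadratic_of_odd` — consequently, for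
  `W/ℚ` elliptic, `K` a quadratic field, `Wd ≅ W^{(d_K)}` over `ℚ`, `W' ≅ W_K` over `K` with
  `E(K) = W'(K)` finite, and every odd prime `p`:
  **`#Ш(W'/K)[p^∞] = #Ш(W/ℚ)[p^∞] · #Ш(Wd/ℚ)[p^∞]`** (`Nat.card`, so also in the infinite case).

The `2`-primary part of the `Ш`-term is NOT a product in general: together with the `2`-parts of
the Tamagawa, torsion and period terms it is governed by global duality (Cassels–Tate pairing and
the Poitou–Tate/Cassels formula for the Selmer ratio of the isogeny `E × E^{(D)} → Res_{K/ℚ}E_K`),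
which is what remains of `bsdRHS_baseChange_quadratic` (see the unit notes).

## References

* T. Dokchitser, V. Dokchitser, *On the Birch–Swinnerton-Dyer quotients modulo squares*, Ann. of
  Math. 172 (2010), Lemma 4.14 (proof) and §2.1. [DokchitserDokchitserAnnals2010]
* R. Greenberg, *Iwasawa theory for elliptic curves*, LNM 1716 (1999), §2, pp. 62–63 (the
  fundamental sequence). [Greenberg1999]
* J. S. Milne, *On the arithmetic of abelian varieties*, Invent. Math. 17 (1972), §1.
  [Milne1972ArithmeticAV]

## Design notes

Theorems only (kernel-reviewed sibling). The group-theoretic lemma and the Selmer statement live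
in the path namespace `Literature.NumberTheory.EllipticCurves` (next to `comparisonMap`); the
curve-level statements are deliberate dot-notation extensions of Mathlib's `WeierstrassCurve`
namespace, as in the rest of the topic. `K : Type` (universe `0`) as in `comparisonMap` and in
`bsdRHS_baseChange_quadratic`.
-/

noncomputable section

open scoped Classical

universe u

namespace Literature.NumberTheory.EllipticCurves

open WeierstrassCurve

/-! ## `p`-primary groups, `p` odd: `2`-power-bounded kernel and cokernel are trivial -/

section OddPrimary

variable {A B : Type*} [AddCommGroup A] [AddCommGroup B] {p : ℕ}

/-- **Bézout for `2^a` and `p^k`, `p` odd**: an element `y` of an abelian group is the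
`ℤ`-combination `y = A·(2^a y) + B·(p^k y)` with `2^a A + p^k B = 1`. [folklore] -/
theorem eq_gcdA_zsmul_add_gcdB_zsmul (hp : Odd p) (a k : ℕ) (y : B) :
    y = Nat.gcdA (2 ^ a) (p ^ k) • ((2 ^ a) • y) + Nat.gcdB (2 ^ a) (p ^ k) • ((p ^ k) • y) := by
  have hcop : Nat.Coprime (2 ^ a) (p ^ k) :=
    Nat.Coprime.pow a k hp.coprime_two_left
  have h1 : (1 : ℤ) = ((2 ^ a : ℕ) : ℤ) * Nat.gcdA (2 ^ a) (p ^ k) +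
      ((p ^ k : ℕ) : ℤ) * Nat.gcdB (2 ^ a) (p ^ k) := by
    have := Nat.gcd_eq_gcd_ab (2 ^ a) (p ^ k)
    rwa [Nat.Coprime.gcd_eq_one hcop, Nat.cast_one] at this
  calc y = (1 : ℤ) • y := (one_zsmul y).symm
    _ = (((2 ^ a : ℕ) : ℤ) * Nat.gcdA (2 ^ a) (p ^ k) +
          ((p ^ k : ℕ) : ℤ) * Nat.gcdB (2 ^ a) (p ^ k)) • y := by rw [← h1]
    _ = Nat.gcdA (2 ^ a) (p ^ k) • ((2 ^ a) • y) + Nat.gcdB (2 ^ a) (p ^ k) • ((p ^ k) • y) := by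
        rw [add_zsmul, mul_comm, mul_smul, natCast_zsmul, mul_comm ((p ^ k : ℕ) : ℤ), mul_smul,
          natCast_zsmul]

/-- An element killed by `2^a` and by `p^k`, `p` odd, is `0`. [folklore] -/
theorem eq_zero_of_two_pow_nsmul_of_pow_nsmul (hp : Odd p) {a k : ℕ} {x : A}
    (h2 : (2 ^ a) • x = 0) (hk : (p ^ k) • x = 0) : x = 0 := by
  rw [eq_gcdA_zsmul_add_gcdB_zsmul hp a k x, h2, hk, zsmul_zero, zsmul_zero, add_zero]

/-- **A homomorphism of `p`-primary abelian groups, `p` odd, whose kernel and cokernel are killed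
by `2^a` is an isomorphism.** (Used with `a = 3`: Dokchitser–Dokchitser 2010, proof of Lemma 4.14,
"kernel and cokernel killed by `|G|²`", read at an odd prime.) [folklore] -/
theorem bijective_of_two_pow_nsmul_ker_of_two_pow_nsmul_coker (hp : Odd p) (f : A →+ B)
    (hA : ∀ x : A, ∃ k : ℕ, (p ^ k) • x = 0) (hB : ∀ y : B, ∃ k : ℕ, (p ^ k) • y = 0) {a : ℕ}
    (hker : ∀ x, f x = 0 → (2 ^ a) • x = 0) (hcoker : ∀ y, (2 ^ a) • y ∈ f.range) :
    Function.Bijective f := by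
  constructor
  · refine (injective_iff_map_eq_zero f).mpr fun x hx ↦ ?_
    obtain ⟨k, hk⟩ := hA x
    exact eq_zero_of_two_pow_nsmul_of_pow_nsmul hp (hker x hx) hk
  · intro y
    obtain ⟨k, hk⟩ := hB y
    obtain ⟨x, hx⟩ := hcoker y
    refine ⟨Nat.gcdA (2 ^ a) (p ^ k) • x, ?_⟩
    rw [map_zsmul, hx]
    conv_rhs => rw [eq_gcdA_zsmul_add_gcdB_zsmul hp a k y, hk, zsmul_zero, add_zero]

end OddPrimary

/-! ## The comparison map is an isomorphism at odd primes -/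

section Comparison

variable (W : WeierstrassCurve ℚ) (K : Type) [Field K] [NumberField K] (h2 : Module.finrank ℚ K = 2)
  {θ : K} {c : ℚ} (hθ : θ ∉ Set.range (algebraMap ℚ K)) (hc : θ ^ 2 = algebraMap ℚ K c)
  (p : ℕ)

/-- Elements of a `p^∞`-Selmer group are killed by a power of `p`
(`exists_pow_nsmul_eq_zero_galH1Primary`). [folklore] -/
theorem exists_pow_nsmul_eq_zero_selmerGroupPInfty {F : Type} [Field F] [NumberField F]
    (X : WeierstrassCurve F) (q : ℕ) (x : selmerGroupPInfty X q) : ∃ k : ℕ, (q ^ k) • x = 0 := by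
  obtain ⟨k, hk⟩ := exists_pow_nsmul_eq_zero_galH1Primary X q (x : galH1Primary X q)
  exact ⟨k, Subtype.ext (by rw [AddSubmonoidClass.coe_nsmul, hk, ZeroMemClass.coe_zero])⟩

include h2 in
/-- **`Sel_{p^∞}(E/ℚ) × Sel_{p^∞}(E^{(c)}/ℚ) ≅ Sel_{p^∞}(E/K)` for odd `p`.** For `K = ℚ(θ)`,
`θ² = c`, and an odd prime-power torsion prime `p` (any odd `p`), the comparison map
`(η, η') ↦ res η + ψ_*(res η')` of `BSDSelmerParityDokchitserBaseChangeProofs` is bijective: its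
kernel and cokernel are killed by `8` (`nsmul_eq_zero_of_comparisonMap_eq_zero`,
`nsmul_mem_range_comparisonMap`; Dokchitser–Dokchitser 2010, proof of Lemma 4.14) and the three
Selmer groups are `p`-primary. [cite: DokchitserDokchitserAnnals2010, Lemma 4.14 (proof)] -/
theorem comparisonMap_bijective_of_odd (hp : Odd p) :
    Function.Bijective (comparisonMap W K hθ hc p) := by
  refine bijective_of_two_pow_nsmul_ker_of_two_pow_nsmul_coker hp (comparisonMap W K hθ hc p)
    (fun x ↦ ?_) (exists_pow_nsmul_eq_zero_selmerGroupPInfty (W.baseChange K) p) (a := 3)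
    (fun x hx ↦ nsmul_eq_zero_of_comparisonMap_eq_zero W K h2 hθ hc p x hx)
    (fun y ↦ nsmul_mem_range_comparisonMap W K h2 hθ hc p y)
  obtain ⟨k₁, hk₁⟩ := exists_pow_nsmul_eq_zero_selmerGroupPInfty W p x.1
  obtain ⟨k₂, hk₂⟩ := exists_pow_nsmul_eq_zero_selmerGroupPInfty (W.quadraticTwist c) p x.2
  refine ⟨k₁ + k₂, Prod.ext ?_ ?_⟩
  · rw [Prod.smul_fst, pow_add, mul_comm, mul_smul, hk₁, smul_zero, Prod.fst_zero]
  · rw [Prod.smul_snd, pow_add, mul_smul, hk₂, smul_zero, Prod.snd_zero]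

end Comparison

end Literature.NumberTheory.EllipticCurves

/-! ## `Sel_{p^∞}(E/F) ≅ Ш(E/F)[p^∞]` when `E(F)` is finite, and the odd part of `Ш` over `K` -/

namespace WeierstrassCurve

open Literature.NumberTheory.EllipticCurves Literature.NumberTheory.QuadraticFields

/-- **`#Sel_{p^∞}(E/F) = #Ш(E/F)[p^∞]` when `E(F)` is finite** (number field `F`, prime `p`):
`Sel_{p^∞}(E/F) → H¹(F, E)` is injective when `E(F)` is finite
(`ker_primaryH1ToH1_eq_bot_of_finite`: its kernel is `E(F) ⊗ ℚ_p/ℤ_p = 0`) with image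
`Ш(E/F)[p^∞]` (`map_primaryH1ToH1_selmerGroupPInfty`, from the divisibility of `E(F̄)`,
`zsmul_geomPoints_surjective_holds`) — the rank-`0` case of the fundamental sequence
`0 → E(F) ⊗ ℚ_p/ℤ_p → Sel_{p^∞}(E/F) → Ш(E/F)[p^∞] → 0`, Greenberg (1999), §2, pp. 62–63.
[cite: Greenberg1999, §2, pp. 62–63] -/
theorem card_selmerGroupPInfty_eq_card_primaryComponent_sha {F : Type u} [Field F] [NumberField F]
    (X : WeierstrassCurve F) [X.IsElliptic] (p : ℕ) [Fact p.Prime] [Finite X.toAffine.Point] :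
    Nat.card (selmerGroupPInfty X p) = Nat.card (AddCommGroup.primaryComponent X.sha p) := by
  have hinj : Function.Injective (X.primaryH1ToH1 p) :=
    (AddMonoidHom.ker_eq_bot_iff _).mp (X.ker_primaryH1ToH1_eq_bot_of_finite p)
  have hmap : (selmerGroupPInfty X p).map (X.primaryH1ToH1 p) =
      (AddCommGroup.primaryComponent X.sha p).map X.sha.subtype :=
    X.map_primaryH1ToH1_selmerGroupPInfty p X.zsmul_geomPoints_surjective_holds
  have e₁ := (selmerGroupPInfty X p).equivMapOfInjective (X.primaryH1ToH1 p) hinj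
  have e₂ := (AddCommGroup.primaryComponent X.sha p).equivMapOfInjective X.sha.subtype
    fun _ _ h ↦ Subtype.ext h
  exact Nat.card_congr ((e₁.trans (AddEquiv.addSubgroupCongr hmap)).trans e₂.symm).toEquiv

/-- **The odd part of `Ш` under quadratic base change** (odd-primary part of the `Ш`-term of
Milne 1972, Thm. 1 / Dokchitser–Dokchitser 2010, proof of Thm. 8, in the rank-zero shape of
`bsdRHS_baseChange_quadratic`). Let `W/ℚ` be elliptic, `K` a quadratic field, `Wd` a `ℚ`-model of
the twist `W^{(d_K)}` and `W'` a `K`-model of `W_K`, with `E(K) = W'(K)` finite. Then for every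
odd prime `p`: `#Ш(W'/K)[p^∞] = #Ш(W/ℚ)[p^∞] · #Ш(Wd/ℚ)[p^∞]`.
Proof: `K = ℚ(θ)`, `θ² = c`, `d_K = c q²` (`Quadratic.exists_sq_eq_algebraMap`,
`NumberField.exists_discr_eq_mul_sq`); `E(ℚ)`, `E^{(c)}(ℚ)` are finite
(`finite_point_of_finite_point_baseChange`, `finite_point_quadraticTwist_of_finite_point_baseChange`);
so all `p^∞`-Selmer groups in sight are the `Ш[p^∞]`'s
(`card_selmerGroupPInfty_eq_card_primaryComponent_sha`), `Sel_{p^∞}` is a model invariant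
(`selmerGroupPInftyIso`), and `Sel_{p^∞}(E/ℚ) × Sel_{p^∞}(E^{(c)}/ℚ) ≅ Sel_{p^∞}(E/K)`
(`comparisonMap_bijective_of_odd`).
[cite: DokchitserDokchitserAnnals2010, Lemma 4.14 (proof) and §2.1 (proof of Thm. 8)] -/
theorem card_primaryComponent_sha_baseChange_quadratic_of_odd (W : WeierstrassCurve ℚ)
    [W.IsElliptic] (K : Type) [Field K] [NumberField K] (h2 : Module.finrank ℚ K = 2)
    (Wd : WeierstrassCurve ℚ) [Wd.IsElliptic]
    (hWd : ∃ C : VariableChange ℚ, C • W.quadraticTwist (NumberField.discr K : ℚ) = Wd)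
    (W' : WeierstrassCurve K) [W'.IsElliptic] (hW' : ∃ C : VariableChange K, C • W.baseChange K = W')
    [Finite W'.toAffine.Point] (p : ℕ) [Fact p.Prime] (hp : p ≠ 2) :
    Nat.card (AddCommGroup.primaryComponent W'.sha p) =
      Nat.card (AddCommGroup.primaryComponent W.sha p) *
        Nat.card (AddCommGroup.primaryComponent Wd.sha p) := by
  obtain ⟨θ, c, hθ, hc⟩ := Quadratic.exists_sq_eq_algebraMap (F := ℚ) (K := K) h2
  obtain ⟨q, hq, hd⟩ := NumberField.exists_discr_eq_mul_sq h2 hθ hc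
  obtain ⟨C₁, hC₁⟩ := W.exists_variableChange_quadraticTwist_mul_sq c q hq
  rw [← hd] at hC₁
  obtain ⟨Cd, hCd⟩ := hWd
  obtain ⟨C', hC'⟩ := hW'
  subst hCd hC'
  have hc0 : c ≠ 0 := by
    rintro rfl
    apply Quadratic.ne_zero_of_not_mem_range hθ
    have : θ ^ 2 = 0 := by rw [hc, map_zero]
    exact pow_eq_zero_iff (n := 2) (by norm_num) |>.mp this
  haveI : (W.quadraticTwist c).IsElliptic := W.isElliptic_quadraticTwist hc0
  haveI : (W.baseChange K).IsElliptic := by rw [baseChange]; infer_instance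
  -- finiteness of the Mordell–Weil groups in sight
  haveI : Finite (W.baseChange K).toAffine.Point :=
    Finite.of_equiv _ (VariableChange.pointEquiv (W.baseChange K) C').toEquiv.symm
  haveI : Finite W.toAffine.Point := finite_point_of_finite_point_baseChange W K
  haveI : Finite (W.quadraticTwist c).toAffine.Point :=
    finite_point_quadraticTwist_of_finite_point_baseChange W K hθ hc
  haveI : Finite (W.quadraticTwist (NumberField.discr K : ℚ)).toAffine.Point := by
    rw [← hC₁]
    exact Finite.of_equiv _ (VariableChange.pointEquiv (W.quadraticTwist c) C₁).toEquiv
  haveI : Finite (Cd • W.quadraticTwist (NumberField.discr K : ℚ)).toAffine.Point :=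
    Finite.of_equiv _ (VariableChange.pointEquiv _ Cd).toEquiv
  -- the comparison isomorphism at the odd prime `p`
  have hodd : Odd p := (Fact.out : p.Prime).odd_of_ne_two hp
  have e := AddEquiv.ofBijective _ (comparisonMap_bijective_of_odd W K h2 hθ hc p hodd)
  have hK : Nat.card (selmerGroupPInfty (W.baseChange K) p) =
      Nat.card (selmerGroupPInfty W p) * Nat.card (selmerGroupPInfty (W.quadraticTwist c) p) := by
    rw [← Nat.card_congr e.toEquiv, Nat.card_prod]
  -- transport to the models `W'`, `Wd` and to `Ш[p^∞]`
  rw [← (C' • W.baseChange K).card_selmerGroupPInfty_eq_card_primaryComponent_sha p,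
    ← W.card_selmerGroupPInfty_eq_card_primaryComponent_sha p,
    ← (Cd • W.quadraticTwist (NumberField.discr K : ℚ)).card_selmerGroupPInfty_eq_card_primaryComponent_sha p,
    ← Nat.card_congr (selmerGroupPInftyIso p (rfl : C' • W.baseChange K = _)).toEquiv, hK,
    ← Nat.card_congr (selmerGroupPInftyIso p
      (rfl : Cd • W.quadraticTwist (NumberField.discr K : ℚ) = _)).toEquiv,
    ← Nat.card_congr (selmerGroupPInftyIso p hC₁).toEquiv]

end WeierstrassCurve

end
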